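import Summits.HubbardSuperconductivity.HubbardSuperconductivity.Theorems.BalabanIRBirEveryGroundStateSocket
import Literature.MathematicalPhysics.QuantumLattice.GriffithsLemmaGroundStates
import Literature.MathematicalPhysics.QuantumLattice.SectorGroundProjContinuity
import Literature.MathematicalPhysics.QuantumLattice.HubbardPairDensityCouplingFloor
import Mathlib.Topology.Baire.Lemmas
import Mathlib.Topology.Baire.CompleteMetrizable
import Mathlib.Analysis.Convex.Continuous
import HarnessLib

/-!
# Crux `BirEveryGroundState` (item `stmt-HubbardSuperconductivity-2083`): closed dark coupling sets and Baire selection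

Helper file `--supports stmt-HubbardSuperconductivity-2083`
(`Summit.HubbardSuperconductivity.HubbardSuperconductivity.Theses.BalabanIR.BirEveryGroundState`,
crux 5 of route BalabanIR: ground-state AVERAGE of `Δ_d† Δ_d` at least `c L⁴` at every coupling of a
window ⇒ at SOME coupling of the window EVERY normalised sector ground-state sequence has
`d_{x²-y²}` pair-field long-range order). This module deliberately imports NO route file (rev-5
materialisation rule), so that closing modules may import it; the companion
`…BirEveryGroundStateDenseBright.lean` draws the consequences for the crux by name.

Fix a side `L`, a sector `(N, S^z = M)` and a threshold `a`. A coupling `U` is *`a`-dark* when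
`hubbardTorus 2 L 1 U` has a normalised sector ground state `ψ` with `Re ⟨ψ, B ψ⟩ ≤ a`
(`B = Δ_d† Δ_d` in the application), and *`a`-bright* otherwise (every normalised sector ground
state has `Re ⟨ψ, B ψ⟩ > a`, i.e. the bottom eigenvalue of the compression of `B` to the sector
ground eigenspace exceeds `a`).

* `isClosed_setOf_exists_darkGround` — abstract: along an affine Hermitian pencil
  `A(u) = H + u • Y` and for any sector `K`, the set of `a`-dark parameters `u` is CLOSED
  (upper semicontinuity of the sector ground multiplet: limits of unit ground vectors along
  `u → u₀` are unit ground vectors at `u₀`, because the sector energy is concave, hence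
  continuous, in `u`). Equivalently the bottom eigenvalue of the ground compression of `B` is
  lower semicontinuous in `u`. Kato (1966) II-§5.1.
* `isClosed_darkCouplings` — the same for the Hubbard torus pencil `U ↦ hubbardTorus 2 L 1 U`
  and the tree's predicate `IsGroundStateInSector`.
* `exists_mem_Ioo_forall_of_denseOpen` — Baire selection on a window: countably many open sets,
  each meeting every sub-interval of `(a, b)`, have a common point in `(a, b)`.
* `exists_forall_bright_of_denseBright` — consequence: if for every even side `L ≥ L₀` the
  `c' L⁴`-bright couplings of side `L` meet every sub-interval of `(a, b)`, then ONE coupling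
  `U ∈ (a, b)` is `c' L⁴`-bright at EVERY even side `L ≥ L₀` (same `c'`, same `L₀`);
* `exists_everyGroundStateLRO_of_denseBright` — hence at that coupling the conclusion body of the
  crux holds: every admissible normalised sector ground-state sequence has `d_{x²-y²}` pair-field
  long-range order (`forall_hasLRO_iff_groundState_bound`).

So "average ⇒ every" needs, per window, only a PER-SIDE density statement (brightness of a dense
set of couplings at each large even side, with one constant) — Baire supplies the common coupling.
Folklore finite-dimensional spectral theory and point-set topology; no definitions, no named facts.
-/

noncomputable section

-- the mandated namespace `Summit.<Summit>.<Problem>.Theorems` repeats `HubbardSuperconductivity`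
-- (single-problem summit, D-0017), which the `dupNamespace` linter flags on every declaration
set_option linter.dupNamespace false

namespace Summit.HubbardSuperconductivity.HubbardSuperconductivity.Theorems

namespace DenseBright

open Matrix Set Filter Topology
open Literature.MathematicalPhysics.QuantumLattice Literature.Probability.LatticeModels
open Literature.MathematicalPhysics.QuantumLattice.EigenvalueContinuation

/-! ### Abstract: the dark parameters of an affine Hermitian pencil form a closed set -/

/-- **Dark parameter sets are closed (upper semicontinuity of the ground multiplet).** Let
`A(u) = H + u • Y` be an affine pencil of Hermitian matrices, `K` a subspace (sector), `B` any
matrix and `a ∈ ℝ`. The set of parameters `u` at which some unit vector `ψ ∈ K` with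
`A(u) ψ = e_K(u) ψ` (`e_K(u) = minEnergyOn (A u) K`, a sector ground vector) has `Re ⟨ψ, B ψ⟩ ≤ a`
is closed in `ℝ`: along `uₙ → u₀` a subsequence of such unit vectors converges (compact unit
sphere of `K`), the eigen-equations pass to the limit because `e_K` is concave hence continuous in
`u` (Griffiths), and `Re ⟨ψ, B ψ⟩ ≤ a` is a closed condition. Kato (1966) II-§5.1; Griffiths,
Phys. Rev. 152 (1966) 240 §II. [folklore] -/
theorem isClosed_setOf_exists_darkGround {ι : Type*} [Fintype ι] [DecidableEq ι]
    {H Y : Matrix ι ι ℂ} (hH : H.IsHermitian) (hY : Y.IsHermitian) (B : Matrix ι ι ℂ)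
    (K : Submodule ℂ (ι → ℂ)) (a : ℝ) :
    IsClosed {u : ℝ | ∃ ψ ∈ K, star ψ ⬝ᵥ ψ = 1 ∧
      (H + (u : ℂ) • Y) *ᵥ ψ = (((H + (u : ℂ) • Y).minEnergyOn K : ℝ) : ℂ) • ψ ∧
      (star ψ ⬝ᵥ B *ᵥ ψ).re ≤ a} := by
  classical
  by_cases hK : K = ⊥
  · -- the trivial sector carries no unit vector: the set is empty
    convert isClosed_empty (X := ℝ)
    refine Set.eq_empty_of_forall_notMem fun u => ?_
    rintro ⟨ψ, hψK, hψ1, -, -⟩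
    rw [hK, Submodule.mem_bot] at hψK
    rw [hψK, dotProduct_zero] at hψ1
    exact zero_ne_one hψ1
  refine IsSeqClosed.isClosed fun u u₀ hu hlim => ?_
  choose ψ hψK hψ1 heig hdark using hu
  -- compactness of the unit sphere of `K`: a convergent subsequence
  obtain ⟨φ, ⟨hφK, hφ1⟩, g, hg, hφlim⟩ :=
    (isCompact_unitSphere_inter K).tendsto_subseq (x := ψ) fun n => ⟨hψK n, hψ1 n⟩
  -- the sector energy is continuous along the pencil (concave on `ℝ`)
  set e : ℝ → ℝ := fun s => (H + (s : ℂ) • Y).minEnergyOn K with he_def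
  have he_cont : Continuous e :=
    continuousOn_univ.1 ((concaveOn_minEnergyOn_pencil hH hY hK).continuousOn isOpen_univ)
  have hug : Tendsto (fun n => u (g n)) atTop (𝓝 u₀) := hlim.comp hg.tendsto_atTop
  -- the eigen-equations along the subsequence, and their limit
  have hl1 : Tendsto (fun n => H *ᵥ ψ (g n) + ((u (g n) : ℝ) : ℂ) • (Y *ᵥ ψ (g n))) atTop
      (𝓝 (H *ᵥ φ + ((u₀ : ℝ) : ℂ) • (Y *ᵥ φ))) := by
    have hu' : Tendsto (fun n => ((u (g n) : ℝ) : ℂ)) atTop (𝓝 ((u₀ : ℝ) : ℂ)) :=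
      (Complex.continuous_ofReal.tendsto u₀).comp hug
    have hH' : Tendsto (fun n => H *ᵥ ψ (g n)) atTop (𝓝 (H *ᵥ φ)) :=
      ((Matrix.mulVecLin H).continuous_of_finiteDimensional.tendsto φ).comp hφlim
    have hY' : Tendsto (fun n => Y *ᵥ ψ (g n)) atTop (𝓝 (Y *ᵥ φ)) :=
      ((Matrix.mulVecLin Y).continuous_of_finiteDimensional.tendsto φ).comp hφlim
    exact hH'.add (hu'.smul hY')
  have hl2 : Tendsto (fun n => ((e (u (g n)) : ℝ) : ℂ) • ψ (g n)) atTop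
      (𝓝 (((e u₀ : ℝ) : ℂ) • φ)) := by
    have he' : Tendsto (fun n => ((e (u (g n)) : ℝ) : ℂ)) atTop (𝓝 ((e u₀ : ℝ) : ℂ)) :=
      (Complex.continuous_ofReal.tendsto _).comp ((he_cont.tendsto u₀).comp hug)
    exact he'.smul hφlim
  have heig' : ∀ n, H *ᵥ ψ (g n) + ((u (g n) : ℝ) : ℂ) • (Y *ᵥ ψ (g n)) =
      ((e (u (g n)) : ℝ) : ℂ) • ψ (g n) := fun n => by
    have h := heig (g n)
    rwa [add_mulVec, smul_mulVec] at h
  have heq : H *ᵥ φ + ((u₀ : ℝ) : ℂ) • (Y *ᵥ φ) = ((e u₀ : ℝ) : ℂ) • φ :=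
    tendsto_nhds_unique (hl1.congr heig') hl2
  -- `Re ⟨ψ, B ψ⟩ ≤ a` is a closed condition
  have hray : (star φ ⬝ᵥ B *ᵥ φ).re ≤ a :=
    le_of_tendsto (((continuous_energy B).tendsto φ).comp hφlim)
      (Eventually.of_forall fun n => hdark (g n))
  refine ⟨φ, hφK, hφ1, ?_, hray⟩
  rw [add_mulVec, smul_mulVec]
  exact heq

/-! ### The Hubbard torus: dark coupling sets are closed -/

/-- **The `a`-dark couplings of a side `L` form a closed set.** For the torus Hubbard pencil
`U ↦ hubbardTorus 2 L 1 U = H(1,0) + U · Σ_x n_{x↑} n_{x↓}`, any sector `(N, S^z = M)`, any matrix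
`B` and threshold `a`: the set of couplings `U` admitting a normalised sector ground state `ψ`
(`IsGroundStateInSector`) with `Re ⟨ψ, B ψ⟩ ≤ a` is closed in `ℝ`
(`isClosed_setOf_exists_darkGround`). Kato (1966) II-§5.1. [folklore] -/
theorem isClosed_darkCouplings (L N : ℕ) (M a : ℝ)
    (B : Matrix (Finset (Orb (FermionTorus 2 L))) (Finset (Orb (FermionTorus 2 L))) ℂ) :
    IsClosed {U : ℝ | ∃ ψ : Fock (Orb (FermionTorus 2 L)),
      IsGroundStateInSector (hubbardTorus 2 L 1 U) N M ψ ∧ star ψ ⬝ᵥ ψ = 1 ∧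
      (star ψ ⬝ᵥ B *ᵥ ψ).re ≤ a} := by
  classical
  set D : Matrix (Finset (Orb (FermionTorus 2 L))) (Finset (Orb (FermionTorus 2 L))) ℂ :=
    ∑ x : FermionTorus 2 L, numberOp x 0 * numberOp x 1 with hD
  -- the pencil `hubbardTorus 2 L 1 U = H(0) + U • D`, Hermitian
  have hpen : ∀ u : ℝ, hubbardTorus 2 L 1 u = hubbardTorus 2 L 1 0 + (u : ℂ) • D := fun u =>
    hubbardTorus_eq_zero_add_smul_interaction u
  have hHh : ∀ u : ℝ, (hubbardTorus 2 L 1 u).IsHermitian := fun u =>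
    hubbardTorus_isHermitian (hamiltonian_isHermitian_and_commute_holds (fermionTorusGraph 2 L))
      1 u
  have hDeq : D = hubbardTorus 2 L 1 1 - hubbardTorus 2 L 1 0 := by
    rw [hpen 1, Complex.ofReal_one, one_smul, add_sub_cancel_left]
  have hDh : D.IsHermitian := by rw [hDeq]; exact (hHh 1).sub (hHh 0)
  have h := isClosed_setOf_exists_darkGround (hHh 0) hDh B
    (szSector (Λ := FermionTorus 2 L) N M) a
  simp only [← hpen] at h
  convert h using 1
  ext U
  simp only [Set.mem_setOf_eq, IsGroundStateInSector]
  constructor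
  · rintro ⟨ψ, ⟨hψS, -, hHψ⟩, hψ1, hd⟩
    exact ⟨ψ, hψS, hψ1, hHψ, hd⟩
  · rintro ⟨ψ, hψS, hψ1, hHψ, hd⟩
    refine ⟨ψ, ⟨hψS, ?_, hHψ⟩, hψ1, hd⟩
    rintro rfl
    rw [dotProduct_zero] at hψ1
    exact zero_ne_one hψ1

/-! ### Baire selection on a window -/

/-- **Baire selection.** If countably many OPEN subsets `O L ⊆ ℝ` each meet every non-trivial
sub-interval `(u, v)` of a window `[a, b]` (`a < b`), then some point of `(a, b)` lies in all of
them: the open sets `O L ∪ [a, b]ᶜ` are dense in `ℝ`, so their intersection is dense (Baire) and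
meets `(a, b)`. Baire (1899); Mathlib `dense_iInter_of_isOpen_nat`. [folklore] -/
theorem exists_mem_Ioo_forall_of_denseOpen {a b : ℝ} (hab : a < b) (O : ℕ → Set ℝ)
    (hO : ∀ L, IsOpen (O L))
    (hd : ∀ L, ∀ u v : ℝ, a ≤ u → u < v → v ≤ b → ∃ U ∈ Set.Ioo u v, U ∈ O L) :
    ∃ U ∈ Set.Ioo a b, ∀ L, U ∈ O L := by
  let f : ℕ → Set ℝ := fun L => O L ∪ (Set.Icc a b)ᶜ
  have hfo : ∀ L, IsOpen (f L) := fun L => (hO L).union isClosed_Icc.isOpen_compl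
  have hfd : ∀ L, Dense (f L) := by
    intro L x
    by_cases hx : x ∈ Set.Icc a b
    · rw [Metric.mem_closure_iff]
      intro ε hε
      obtain ⟨U, hU, hUO⟩ := hd L (max a (x - ε / 2)) (min b (x + ε / 2)) (le_max_left _ _)
        (max_lt (lt_min hab (by linarith [hx.1])) (lt_min (by linarith [hx.2]) (by linarith)))
        (min_le_left _ _)
      refine ⟨U, Or.inl hUO, ?_⟩
      have h1 : x - ε / 2 < U := lt_of_le_of_lt (le_max_right _ _) hU.1
      have h2 : U < x + ε / 2 := lt_of_lt_of_le hU.2 (min_le_right _ _)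
      rw [Real.dist_eq, abs_sub_lt_iff]
      constructor <;> linarith
    · exact subset_closure (Or.inr hx)
  have hne : (Set.Ioo a b).Nonempty := ⟨(a + b) / 2, by
    rw [Set.mem_Ioo]; constructor <;> linarith⟩
  obtain ⟨U, hUf, hUab⟩ := (dense_iInter_of_isOpen_nat hfo hfd).exists_mem_open isOpen_Ioo hne
  refine ⟨U, hUab, fun L => ?_⟩
  rcases Set.mem_iInter.1 hUf L with h | h
  · exact h
  · exact absurd (Set.Ioo_subset_Icc_self hUab) h

/-! ### Bright coupling sets are open -/

/-- **The `a`-bright couplings of a side `L` form an open set.** `U` is `a`-bright for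
`(L, N, M, B)` when EVERY normalised `(N, S^z = M)`-sector ground state `ψ` of `hubbardTorus 2 L 1 U`
has `a < Re ⟨ψ, B ψ⟩`; this is the complement of the closed dark set of `isClosed_darkCouplings`.
Equivalently: the bottom eigenvalue of the compression of `B` to the sector ground eigenspace is a
lower semicontinuous function of the coupling. Kato (1966) II-§5.1. [folklore] -/
theorem isOpen_brightCouplings (L N : ℕ) (M a : ℝ)
    (B : Matrix (Finset (Orb (FermionTorus 2 L))) (Finset (Orb (FermionTorus 2 L))) ℂ) :
    IsOpen {U : ℝ | ∀ ψ : Fock (Orb (FermionTorus 2 L)),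
      IsGroundStateInSector (hubbardTorus 2 L 1 U) N M ψ → star ψ ⬝ᵥ ψ = 1 →
      a < (star ψ ⬝ᵥ B *ᵥ ψ).re} := by
  have hset : {U : ℝ | ∀ ψ : Fock (Orb (FermionTorus 2 L)),
      IsGroundStateInSector (hubbardTorus 2 L 1 U) N M ψ → star ψ ⬝ᵥ ψ = 1 →
      a < (star ψ ⬝ᵥ B *ᵥ ψ).re} =
      {U : ℝ | ∃ ψ : Fock (Orb (FermionTorus 2 L)),
        IsGroundStateInSector (hubbardTorus 2 L 1 U) N M ψ ∧ star ψ ⬝ᵥ ψ = 1 ∧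
        (star ψ ⬝ᵥ B *ᵥ ψ).re ≤ a}ᶜ := by
    ext U
    simp only [Set.mem_setOf_eq, Set.mem_compl_iff, not_exists, not_and, not_le]
  rw [hset]
  exact (isClosed_darkCouplings L N M a B).isOpen_compl

/-- A set cut out by a condition guarded by two propositions is open as soon as the unguarded
set is open whenever the guards hold (it is all of `ℝ` otherwise). [folklore] -/
private theorem isOpen_setOf_imp_imp {p q : Prop} {s : ℝ → Prop}
    (h : p → q → IsOpen {U | s U}) : IsOpen {U | p → q → s U} := by
  by_cases hp : p
  · by_cases hq : q
    · simpa [hp, hq] using h hp hq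
    · simp [hq]
  · simp [hp]

/-! ### Dense brightness per side ⇒ one coupling bright at every side -/

/-- **Per-side dense brightness ⇒ a common bright coupling.** Fix `δ`, a window `(a, b)`
(`a < b`), a constant `c'` and a threshold `L₀`. Suppose that for every even side `L ≥ L₀` the
`c' L⁴`-BRIGHT couplings of side `L` — those `U` at which every normalised
`(2⌊(1-δ)L²/2⌋, S^z = 0)`-sector ground state of `hubbardTorus 2 L 1 U` has
`c' L⁴ < Re ⟨ψ, Δ_d† Δ_d ψ⟩` — meet every sub-interval of `(a, b)`. Then ONE coupling `U ∈ (a, b)`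
is `c' L⁴`-bright at EVERY even side `L ≥ L₀` (same `c'`, same `L₀`): the bright sets are open
(`isOpen_brightCouplings`) and Baire selection (`exists_mem_Ioo_forall_of_denseOpen`, over the
sides `m + 1`, `m : ℕ`) gives the common point. Kato (1966) II-§5.1; Baire (1899). [folklore] -/
theorem exists_forall_bright_of_denseBright (δ : ℝ) {a b : ℝ} (hab : a < b) (c' : ℝ) (L₀ : ℕ)
    (hd : ∀ (L : ℕ) [NeZero L], L₀ ≤ L → Even L → ∀ u v : ℝ, a ≤ u → u < v → v ≤ b →
      ∃ U ∈ Set.Ioo u v, ∀ ψ : Fock (Orb (FermionTorus 2 L)),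
        IsGroundStateInSector (hubbardTorus 2 L 1 U) (2 * ⌊(1 - δ) * (L : ℝ) ^ 2 / 2⌋₊) 0 ψ →
        star ψ ⬝ᵥ ψ = 1 →
        c' * (L : ℝ) ^ 4 <
          (star ψ ⬝ᵥ ((pairField dWaveFormFactor L)ᴴ * pairField dWaveFormFactor L) *ᵥ ψ).re) :
    ∃ U ∈ Set.Ioo a b, ∀ (L : ℕ) [NeZero L], L₀ ≤ L → Even L →
      ∀ ψ : Fock (Orb (FermionTorus 2 L)),
        IsGroundStateInSector (hubbardTorus 2 L 1 U) (2 * ⌊(1 - δ) * (L : ℝ) ^ 2 / 2⌋₊) 0 ψ →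
        star ψ ⬝ᵥ ψ = 1 →
        c' * (L : ℝ) ^ 4 <
          (star ψ ⬝ᵥ ((pairField dWaveFormFactor L)ᴴ * pairField dWaveFormFactor L) *ᵥ ψ).re := by
  classical
  -- the bright sets of the positive sides `m + 1` (all of `ℝ` at the irrelevant sides) are open …
  have hO : ∀ m : ℕ, IsOpen {U : ℝ | L₀ ≤ m + 1 → Even (m + 1) →
      ∀ ψ : Fock (Orb (FermionTorus 2 (m + 1))),
        IsGroundStateInSector (hubbardTorus 2 (m + 1) 1 U)
          (2 * ⌊(1 - δ) * ((m + 1 : ℕ) : ℝ) ^ 2 / 2⌋₊) 0 ψ →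
        star ψ ⬝ᵥ ψ = 1 →
        c' * ((m + 1 : ℕ) : ℝ) ^ 4 <
          (star ψ ⬝ᵥ ((pairField dWaveFormFactor (m + 1))ᴴ *
            pairField dWaveFormFactor (m + 1)) *ᵥ ψ).re} := by
    intro m
    exact isOpen_setOf_imp_imp fun _ _ => isOpen_brightCouplings (m + 1) _ 0 _ _
  -- … and each meets every sub-interval of the window
  have hdense : ∀ m : ℕ, ∀ u v : ℝ, a ≤ u → u < v → v ≤ b →
      ∃ U ∈ Set.Ioo u v, U ∈ {U : ℝ | L₀ ≤ m + 1 → Even (m + 1) →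
        ∀ ψ : Fock (Orb (FermionTorus 2 (m + 1))),
          IsGroundStateInSector (hubbardTorus 2 (m + 1) 1 U)
            (2 * ⌊(1 - δ) * ((m + 1 : ℕ) : ℝ) ^ 2 / 2⌋₊) 0 ψ →
          star ψ ⬝ᵥ ψ = 1 →
          c' * ((m + 1 : ℕ) : ℝ) ^ 4 <
            (star ψ ⬝ᵥ ((pairField dWaveFormFactor (m + 1))ᴴ *
              pairField dWaveFormFactor (m + 1)) *ᵥ ψ).re} := by
    intro m u v hu huv hv
    by_cases hm : L₀ ≤ m + 1 ∧ Even (m + 1)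
    · obtain ⟨U, hU, hbr⟩ := hd (m + 1) hm.1 hm.2 u v hu huv hv
      exact ⟨U, hU, fun _ _ => hbr⟩
    · refine ⟨(u + v) / 2, ?_, fun h1 h2 => absurd ⟨h1, h2⟩ hm⟩
      rw [Set.mem_Ioo]; constructor <;> linarith
  -- Baire selection over the sides `m + 1`
  obtain ⟨U, hUab, hU⟩ := exists_mem_Ioo_forall_of_denseOpen hab _ hO hdense
  refine ⟨U, hUab, fun L _ hL hE ψ hgs h1 => ?_⟩
  obtain ⟨m, rfl⟩ := Nat.exists_eq_add_one_of_ne_zero (NeZero.ne L)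
  exact hU m hL hE ψ hgs h1

end DenseBright

open Matrix Set Filter Topology
open Literature.MathematicalPhysics.QuantumLattice Literature.Probability.LatticeModels

/-- **Per-side dense brightness ⇒ the crux's conclusion body at one coupling of the window.**
Under the hypothesis of `exists_forall_bright_of_denseBright` with `c' > 0` and `δ ≥ -1`, there is
a coupling `U ∈ (a, b)` at which EVERY admissible normalised `(2⌊(1-δ)L²/2⌋, S^z = 0)`-sector
ground-state sequence of `hubbardTorus 2 L 1 U` has `d_{x²-y²}` pair-field long-range order along
the even sides — the verbatim conclusion body of `Theses.BalabanIR.BirEveryGroundState` / of the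
summit matrix `HasDWavePairFieldLROAt U δ` (`forall_hasLRO_iff_groundState_bound`, ⇐). So the
crux's "average ⇒ every" needs from the Hubbard model, per window carrying the average bound,
only a PER-SIDE statement: at each large even side the bright couplings are dense, with one
constant. Scalapino, Phys. Rep. 250 (1995) 329, §2; Baire (1899). [folklore] -/
theorem exists_everyGroundStateLRO_of_denseBright {δ : ℝ} (hδ : -1 ≤ δ) {a b : ℝ} (hab : a < b)
    {c' : ℝ} (hc' : 0 < c') (L₀ : ℕ)
    (hd : ∀ (L : ℕ) [NeZero L], L₀ ≤ L → Even L → ∀ u v : ℝ, a ≤ u → u < v → v ≤ b →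
      ∃ U ∈ Set.Ioo u v, ∀ ψ : Fock (Orb (FermionTorus 2 L)),
        IsGroundStateInSector (hubbardTorus 2 L 1 U) (2 * ⌊(1 - δ) * (L : ℝ) ^ 2 / 2⌋₊) 0 ψ →
        star ψ ⬝ᵥ ψ = 1 →
        c' * (L : ℝ) ^ 4 <
          (star ψ ⬝ᵥ ((pairField dWaveFormFactor L)ᴴ * pairField dWaveFormFactor L) *ᵥ ψ).re) :
    ∃ U ∈ Set.Ioo a b, ∀ (N : ℕ → ℕ) (ψ : ∀ L, Fock (Orb (FermionTorus 2 L))),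
      (∀ L, Even L → N L = 2 * ⌊(1 - δ) * (L : ℝ) ^ 2 / 2⌋₊ ∧ star (ψ L) ⬝ᵥ ψ L = 1 ∧
        IsGroundStateInSector (hubbardTorus 2 L 1 U) (N L) 0 (ψ L)) →
      HasLongRangeOrder (fun k => halfOpenBox 2 (2 * k))
        (fun k => torusPullback (pairFieldCorr dWaveFormFactor ψ) (2 * k)) := by
  obtain ⟨U, hUab, hU⟩ := DenseBright.exists_forall_bright_of_denseBright δ hab c' L₀ hd
  exact ⟨U, hUab, (forall_hasLRO_iff_groundState_bound U δ hδ).2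
    ⟨c', hc', L₀, fun L _ hL hE ψ hgs h1 => (hU L hL hE ψ hgs h1).le⟩⟩

end Summit.HubbardSuperconductivity.HubbardSuperconductivity.Theorems
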